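import Summits.Ventures.PercRepro.Conditioning

/-!
# Deterministic weights, free-edge induction, pivotal edges (Russo's formula)

Proof infrastructure on top of the one-edge conditioning identities of `Conditioning.lean`.

* `detWeights σ` is the `0/1` weight vector that realises the configuration `σ` surely:
  `prob_detWeights : prob (detWeights σ) A = if σ ∈ A then 1 else 0`.
* `induction_free` is the **free-edge induction principle**: a property of weight vectors that
  holds for every deterministic vector and is preserved by un-fixing one edge
  (`P p[e:=1] → P p[e:=0] → P p`) holds on all of `[0,1]^E`.  Together with `prob_update`
  (`P_{p[e:=x]}(A)` is affine in `x`) this is the standard proof scheme for polynomial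
  inequalities between connection probabilities: the base case is a statement about one
  configuration, the step is the sign of a cross term.
* `pivotalEvent e A` is the event that the state of `e` decides `A`.  The finite
  **Margulis–Russo formula** holds for an arbitrary event,
  `prob_update_one_sub_prob_update_zero :
    P_{p[e:=1]}(A) - P_{p[e:=0]}(A) = P_p(e pivotal for A) - P_p(e pivotal for Aᶜ)`,
  and for an increasing event the second term vanishes (`russo`):
  `P_p(A) = P_{p[e:=0]}(A) + p_e · P_p(e pivotal for A)`, i.e. `∂P_p(A)/∂p_e = P_p(e pivotal)`.
-/

open Finset

namespace PercRepro

variable {E : Type*} [Fintype E] [DecidableEq E]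

/-! ### Deterministic weights -/

/-- The `0/1` weight vector that realises the configuration `σ` surely. -/
def detWeights (σ : Config E) : E → ℝ := fun e => if σ e then 1 else 0

omit [Fintype E] [DecidableEq E] in
/-- Deterministic weights are probabilities. -/
theorem isProb_detWeights (σ : Config E) : IsProb (detWeights σ) := fun e => by
  unfold detWeights
  split_ifs <;> norm_num

omit [DecidableEq E] in
/-- Under `detWeights σ` the configuration `σ` has weight `1` and every other one weight `0`. -/
theorem weight_detWeights (σ ω : Config E) :
    weight (detWeights σ) ω = if ω = σ then 1 else 0 := by
  unfold weight detWeights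
  by_cases h : ω = σ
  · subst h
    rw [if_pos rfl]
    refine Finset.prod_eq_one fun e _ => ?_
    cases ω e <;> simp
  · rw [if_neg h]
    obtain ⟨e, he⟩ := Function.ne_iff.1 h
    refine Finset.prod_eq_zero (Finset.mem_univ e) ?_
    revert he
    cases ω e <;> cases σ e <;> simp

/-- `P_{detWeights σ}(A) = 1_A(σ)`: the law is the point mass at `σ`. -/
theorem prob_detWeights (σ : Config E) (A : Set (Config E)) :
    prob (detWeights σ) A = A.indicator 1 σ := by
  unfold prob
  rw [Finset.sum_eq_single σ]
  · by_cases hσ : σ ∈ A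
    · simp [Set.indicator_of_mem hσ, weight_detWeights]
    · simp [Set.indicator_of_notMem hσ]
  · intro ω _ hne
    by_cases hω : ω ∈ A
    · simp [Set.indicator_of_mem hω, weight_detWeights, hne]
    · simp [Set.indicator_of_notMem hω]
  · intro h
    exact absurd (Finset.mem_univ σ) h

/-- `P_{detWeights σ}(A) = 1` if `σ ∈ A`. -/
theorem prob_detWeights_of_mem {σ : Config E} {A : Set (Config E)} (h : σ ∈ A) :
    prob (detWeights σ) A = 1 := by
  rw [prob_detWeights, Set.indicator_of_mem h, Pi.one_apply]

/-- `P_{detWeights σ}(A) = 0` if `σ ∉ A`. -/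
theorem prob_detWeights_of_notMem {σ : Config E} {A : Set (Config E)} (h : σ ∉ A) :
    prob (detWeights σ) A = 0 := by
  rw [prob_detWeights, Set.indicator_of_notMem h]

/-- `P_{detWeights σ}(A) = if σ ∈ A then 1 else 0` (decidable form). -/
theorem prob_detWeights_eq_ite (σ : Config E) (A : Set (Config E)) [Decidable (σ ∈ A)] :
    prob (detWeights σ) A = if σ ∈ A then 1 else 0 := by
  split_ifs with h
  · exact prob_detWeights_of_mem h
  · exact prob_detWeights_of_notMem h

/-- `E_{detWeights σ}[f] = f σ`. -/
theorem expect_detWeights (σ : Config E) (f : Config E → ℝ) :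
    expect (detWeights σ) f = f σ := by
  unfold expect
  rw [Finset.sum_eq_single σ]
  · simp [weight_detWeights]
  · intro ω _ hne
    simp [weight_detWeights, hne]
  · intro h
    exact absurd (Finset.mem_univ σ) h

/-! ### Free edges and the induction principle -/

/-- `FreeOn p S`: every edge outside `S` has a deterministic weight (`0` or `1`); the edges of
`S` are the ones that may still be "free". -/
def FreeOn (p : E → ℝ) (S : Finset E) : Prop := ∀ e, e ∉ S → p e = 0 ∨ p e = 1

omit [Fintype E] [DecidableEq E] in
/-- Enlarging the set of free edges preserves `FreeOn`. -/
theorem FreeOn.mono {p : E → ℝ} {S T : Finset E} (h : FreeOn p S) (hST : S ⊆ T) : FreeOn p T :=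
  fun e he => h e fun h' => he (hST h')

omit [Fintype E] in
/-- Fixing the free edge `e` to a deterministic value removes it from the free set. -/
theorem FreeOn.update {p : E → ℝ} {S : Finset E} {e : E} (h : FreeOn p (insert e S)) {x : ℝ}
    (hx : x = 0 ∨ x = 1) : FreeOn (Function.update p e x) S := by
  intro e' he'
  by_cases hee : e' = e
  · subst hee
    simpa using hx
  · rw [Function.update_of_ne hee]
    exact h e' (by simp [hee, he'])

omit [Fintype E] [DecidableEq E] in
/-- A weight vector with no free edge is deterministic. -/
theorem eq_detWeights_of_freeOn_empty {p : E → ℝ} (h : FreeOn p ∅) :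
    p = detWeights fun e => decide (p e = 1) := by
  funext e
  rcases h e (Finset.notMem_empty e) with h0 | h1
  · simp [detWeights, h0]
  · simp [detWeights, h1]

/-- **Free-edge induction.** A property of weight vectors that holds for every deterministic
(`0/1`) vector and is preserved by un-fixing one edge (`P p[e:=1] → P p[e:=0] → P p`) holds
for every `p ∈ [0,1]^E`. -/
theorem induction_free {P : (E → ℝ) → Prop}
    (base : ∀ σ : Config E, P (detWeights σ))
    (step : ∀ p e, IsProb p → P (Function.update p e 1) → P (Function.update p e 0) → P p)
    {p : E → ℝ} (hp : IsProb p) : P p := by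
  suffices key : ∀ S : Finset E, ∀ p, IsProb p → FreeOn p S → P p from
    key univ p hp fun e he => absurd (Finset.mem_univ e) he
  intro S
  induction S using Finset.induction_on with
  | empty =>
    intro p _ hfree
    rw [eq_detWeights_of_freeOn_empty hfree]
    exact base _
  | insert e S _ ih =>
    intro p hp hfree
    refine step p e hp ?_ ?_
    · exact ih _ (hp.update e ⟨zero_le_one, le_rfl⟩) (hfree.update (Or.inr rfl))
    · exact ih _ (hp.update e ⟨le_rfl, zero_le_one⟩) (hfree.update (Or.inl rfl))

/-! ### `P_{p[e:=x]}(A)` is affine in `x` -/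

/-- `P_{p[e:=x]}(A) = x · P_{p[e:=1]}(A) + (1 - x) · P_{p[e:=0]}(A)`: the probability of any
event is an affine function of each single edge probability. -/
theorem prob_update (p : E → ℝ) (e : E) (x : ℝ) (A : Set (Config E)) :
    prob (Function.update p e x) A =
      x * prob (Function.update p e 1) A + (1 - x) * prob (Function.update p e 0) A := by
  have h := prob_split (Function.update p e x) e A
  rwa [Function.update_idem, Function.update_idem, Function.update_self] at h

/-- Affine form of `prob_update`:
`P_{p[e:=x]}(A) = P_{p[e:=0]}(A) + x · (P_{p[e:=1]}(A) - P_{p[e:=0]}(A))`. -/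
theorem prob_update_eq_add_mul (p : E → ℝ) (e : E) (x : ℝ) (A : Set (Config E)) :
    prob (Function.update p e x) A =
      prob (Function.update p e 0) A
        + x * (prob (Function.update p e 1) A - prob (Function.update p e 0) A) := by
  rw [prob_update]
  ring

/-- `P_p(A) = P_{p[e:=0]}(A) + p_e · (P_{p[e:=1]}(A) - P_{p[e:=0]}(A))`. -/
theorem prob_eq_prob_update_zero_add_mul (p : E → ℝ) (e : E) (A : Set (Config E)) :
    prob p A =
      prob (Function.update p e 0) A
        + p e * (prob (Function.update p e 1) A - prob (Function.update p e 0) A) := by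
  rw [prob_split p e A]
  ring

/-! ### Transport along the edge flip -/

/-- Two events with the same trace on `{e open}` have the same `p[e:=1]`-probability. -/
theorem prob_update_one_congr (p : E → ℝ) (e : E) {A B : Set (Config E)}
    (h : ∀ ω : Config E, ω e = true → (ω ∈ A ↔ ω ∈ B)) :
    prob (Function.update p e 1) A = prob (Function.update p e 1) B := by
  have hAB : A ∩ {ω | ω e = true} = B ∩ {ω | ω e = true} := by
    ext ω
    simp only [Set.mem_inter_iff, Set.mem_setOf_eq]
    constructor
    · rintro ⟨hA, he⟩
      exact ⟨(h ω he).1 hA, he⟩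
    · rintro ⟨hB, he⟩
      exact ⟨(h ω he).2 hB, he⟩
  rw [← prob_update_one_inter_open, hAB, prob_update_one_inter_open]

/-- Two events with the same trace on `{e closed}` have the same `p[e:=0]`-probability. -/
theorem prob_update_zero_congr (p : E → ℝ) (e : E) {A B : Set (Config E)}
    (h : ∀ ω : Config E, ω e = false → (ω ∈ A ↔ ω ∈ B)) :
    prob (Function.update p e 0) A = prob (Function.update p e 0) B := by
  have hAB : A ∩ {ω | ω e = false} = B ∩ {ω | ω e = false} := by
    ext ω
    simp only [Set.mem_inter_iff, Set.mem_setOf_eq]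
    constructor
    · rintro ⟨hA, he⟩
      exact ⟨(h ω he).1 hA, he⟩
    · rintro ⟨hB, he⟩
      exact ⟨(h ω he).2 hB, he⟩
  rw [← prob_update_zero_inter_closed, hAB, prob_update_zero_inter_closed]

/-- **Flip transport**: `P_{p[e:=0]}(A) = P_{p[e:=1]}(flipEdge e ⁻¹' A)` — closing `e` surely
and asking for `A` is the same as opening `e` surely and asking for `A` after flipping `e`. -/
theorem prob_update_zero_eq_prob_update_one_preimage (p : E → ℝ) (e : E) (A : Set (Config E)) :
    prob (Function.update p e 0) A = prob (Function.update p e 1) (flipEdge e ⁻¹' A) := by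
  unfold prob
  simp only [indicator_weight_update_zero, indicator_weight_update_one]
  rw [← (flipEdge_involutive e).bijective.sum_comp]
  refine Finset.sum_congr rfl fun ω _ => ?_
  have hw : weightErase p e (flipEdge e ω) = weightErase p e ω := weightErase_flipEdge p e ω
  by_cases hA : flipEdge e ω ∈ A <;> cases h : ω e <;>
    simp [Set.indicator, hA, h, hw, Set.mem_preimage]

/-- **Flip transport**, the other direction:
`P_{p[e:=1]}(A) = P_{p[e:=0]}(flipEdge e ⁻¹' A)`. -/
theorem prob_update_one_eq_prob_update_zero_preimage (p : E → ℝ) (e : E) (A : Set (Config E)) :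
    prob (Function.update p e 1) A = prob (Function.update p e 0) (flipEdge e ⁻¹' A) := by
  rw [prob_update_zero_eq_prob_update_one_preimage]
  congr 1
  ext ω
  simp [Set.mem_preimage, flipEdge_flipEdge]

/-! ### Pivotal edges and the Margulis–Russo formula -/

/-- The edge `e` is **pivotal** for `A` in `ω`: with `e` open `A` occurs, with `e` closed it
does not. -/
def pivotalEvent (e : E) (A : Set (Config E)) : Set (Config E) :=
  {ω | Function.update ω e true ∈ A ∧ Function.update ω e false ∉ A}

omit [Fintype E] in
/-- Membership in the pivotal event. -/
theorem mem_pivotalEvent {e : E} {A : Set (Config E)} {ω : Config E} :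
    ω ∈ pivotalEvent e A ↔
      Function.update ω e true ∈ A ∧ Function.update ω e false ∉ A :=
  Iff.rfl

omit [Fintype E] in
/-- Pivotality of `e` does not depend on the state of `e` itself. -/
theorem update_mem_pivotalEvent_iff (e : E) (A : Set (Config E)) (ω : Config E) (b : Bool) :
    Function.update ω e b ∈ pivotalEvent e A ↔ ω ∈ pivotalEvent e A := by
  simp [pivotalEvent, Function.update_idem]

omit [Fintype E] in
/-- The pivotal event is invariant under flipping `e`. -/
theorem flipEdge_preimage_pivotalEvent (e : E) (A : Set (Config E)) :
    flipEdge e ⁻¹' pivotalEvent e A = pivotalEvent e A := by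
  ext ω
  rw [Set.mem_preimage, flipEdge, update_mem_pivotalEvent_iff]

omit [Fintype E] in
/-- On `{e open}`, `e` is pivotal for `A` iff `A` holds and fails after closing `e`. -/
theorem mem_pivotalEvent_of_eq_true {e : E} {A : Set (Config E)} {ω : Config E}
    (h : ω e = true) : ω ∈ pivotalEvent e A ↔ ω ∈ A ∧ flipEdge e ω ∉ A := by
  have h1 : Function.update ω e true = ω := by
    rw [← h, Function.update_eq_self]
  have h2 : Function.update ω e false = flipEdge e ω := by
    rw [flipEdge, h]
    rfl
  rw [mem_pivotalEvent, h1, h2]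

/-- `P_{p[e:=1]}(e pivotal) = P_{p[e:=0]}(e pivotal)`. -/
theorem prob_update_one_pivotalEvent (p : E → ℝ) (e : E) (A : Set (Config E)) :
    prob (Function.update p e 1) (pivotalEvent e A) =
      prob (Function.update p e 0) (pivotalEvent e A) := by
  rw [prob_update_zero_eq_prob_update_one_preimage, flipEdge_preimage_pivotalEvent]

/-- The probability that `e` is pivotal does not depend on `p_e`:
`P_{p[e:=x]}(e pivotal for A) = P_p(e pivotal for A)`. -/
theorem prob_pivotalEvent_update (p : E → ℝ) (e : E) (x : ℝ) (A : Set (Config E)) :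
    prob (Function.update p e x) (pivotalEvent e A) = prob p (pivotalEvent e A) := by
  rw [prob_update, prob_split p e, prob_update_one_pivotalEvent]
  ring

/-- `P_p(e pivotal for A) = P_{p[e:=1]}(e pivotal for A)`. -/
theorem prob_pivotalEvent_eq_update_one (p : E → ℝ) (e : E) (A : Set (Config E)) :
    prob p (pivotalEvent e A) = prob (Function.update p e 1) (pivotalEvent e A) :=
  (prob_pivotalEvent_update p e 1 A).symm

/-- **Margulis–Russo formula, general form**: for an arbitrary event `A`,
`P_{p[e:=1]}(A) - P_{p[e:=0]}(A) = P_p(e pivotal for A) - P_p(e pivotal for Aᶜ)`. -/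
theorem prob_update_one_sub_prob_update_zero (p : E → ℝ) (e : E) (A : Set (Config E)) :
    prob (Function.update p e 1) A - prob (Function.update p e 0) A =
      prob p (pivotalEvent e A) - prob p (pivotalEvent e Aᶜ) := by
  set q := Function.update p e 1 with hq
  have h1 : prob q A = prob q (A ∩ flipEdge e ⁻¹' A) + prob q (pivotalEvent e A) := by
    rw [← prob_inter_add_prob_inter_compl q A (flipEdge e ⁻¹' A)]
    congr 1
    refine prob_update_one_congr p e fun ω he => ?_
    rw [mem_pivotalEvent_of_eq_true he]
    simp [Set.mem_preimage]
  have h0 : prob (Function.update p e 0) A =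
      prob q (A ∩ flipEdge e ⁻¹' A) + prob q (pivotalEvent e Aᶜ) := by
    rw [prob_update_zero_eq_prob_update_one_preimage, ← hq,
      ← prob_inter_add_prob_inter_compl q (flipEdge e ⁻¹' A) A,
      Set.inter_comm (flipEdge e ⁻¹' A) A]
    congr 1
    refine prob_update_one_congr p e fun ω he => ?_
    rw [mem_pivotalEvent_of_eq_true he]
    simp only [Set.mem_inter_iff, Set.mem_preimage, Set.mem_compl_iff, not_not]
    exact and_comm
  rw [h1, h0, prob_pivotalEvent_eq_update_one p e A, prob_pivotalEvent_eq_update_one p e Aᶜ]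
  ring

omit [Fintype E] in
/-- For an increasing event no edge is pivotal for the complement. -/
theorem pivotalEvent_compl_eq_empty_of_isUpperSet (e : E) {A : Set (Config E)}
    (hA : IsUpperSet A) : pivotalEvent e Aᶜ = ∅ := by
  ext ω
  simp only [mem_pivotalEvent, Set.mem_compl_iff, not_not, Set.mem_empty_iff_false, iff_false,
    not_and]
  intro hnot hmem
  exact hnot (hA ((update_false_le ω e).trans (le_update_true ω e)) hmem)

/-- **Margulis–Russo formula** for an increasing event:
`P_{p[e:=1]}(A) - P_{p[e:=0]}(A) = P_p(e pivotal for A)`. -/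
theorem prob_update_one_sub_prob_update_zero_of_isUpperSet (p : E → ℝ) (e : E)
    {A : Set (Config E)} (hA : IsUpperSet A) :
    prob (Function.update p e 1) A - prob (Function.update p e 0) A =
      prob p (pivotalEvent e A) := by
  rw [prob_update_one_sub_prob_update_zero, pivotalEvent_compl_eq_empty_of_isUpperSet e hA,
    prob_empty, sub_zero]

/-- **Russo's formula** (finite form): for an increasing event `A`,
`P_p(A) = P_{p[e:=0]}(A) + p_e · P_p(e pivotal for A)`, i.e. `∂P_p(A)/∂p_e = P_p(e pivotal)`. -/
theorem russo (p : E → ℝ) (e : E) {A : Set (Config E)} (hA : IsUpperSet A) :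
    prob p A = prob (Function.update p e 0) A + p e * prob p (pivotalEvent e A) := by
  rw [prob_eq_prob_update_zero_add_mul p e A,
    prob_update_one_sub_prob_update_zero_of_isUpperSet p e hA]

/-- Russo's formula, general events: `P_p(A) = P_{p[e:=0]}(A) + p_e · (P_p(e pivotal for A) -
P_p(e pivotal for Aᶜ))`. -/
theorem russo_general (p : E → ℝ) (e : E) (A : Set (Config E)) :
    prob p A = prob (Function.update p e 0) A
      + p e * (prob p (pivotalEvent e A) - prob p (pivotalEvent e Aᶜ)) := by
  rw [prob_eq_prob_update_zero_add_mul p e A, prob_update_one_sub_prob_update_zero]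

/-- Pivotality is monotone in the event only through its trace: the pivotal probability of an
increasing event is nonnegative (a sanity corollary of `prob_nonneg`). -/
theorem prob_pivotalEvent_nonneg {p : E → ℝ} (hp : IsProb p) (e : E) (A : Set (Config E)) :
    0 ≤ prob p (pivotalEvent e A) :=
  prob_nonneg hp _

/-- **Russo's formula, derivative form**: `x ↦ P_{p[e:=x]}(A)` has derivative
`P_p(e pivotal for A) - P_p(e pivotal for Aᶜ)` (everywhere, the map being affine). -/
theorem hasDerivAt_prob_update (p : E → ℝ) (e : E) (A : Set (Config E)) (x : ℝ) :
    HasDerivAt (fun x => prob (Function.update p e x) A)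
      (prob p (pivotalEvent e A) - prob p (pivotalEvent e Aᶜ)) x := by
  have h : (fun x => prob (Function.update p e x) A) = fun x =>
      prob (Function.update p e 0) A
        + x * (prob p (pivotalEvent e A) - prob p (pivotalEvent e Aᶜ)) := by
    funext x
    rw [prob_update_eq_add_mul, prob_update_one_sub_prob_update_zero]
  rw [h]
  simpa using (hasDerivAt_mul_const
    (prob p (pivotalEvent e A) - prob p (pivotalEvent e Aᶜ)) (x := x)).const_add
    (prob (Function.update p e 0) A)

/-- **Russo's formula, derivative form, increasing events**:
`d/dx P_{p[e:=x]}(A) = P_p(e pivotal for A)`. -/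
theorem hasDerivAt_prob_update_of_isUpperSet (p : E → ℝ) (e : E) {A : Set (Config E)}
    (hA : IsUpperSet A) (x : ℝ) :
    HasDerivAt (fun x => prob (Function.update p e x) A) (prob p (pivotalEvent e A)) x := by
  have h := hasDerivAt_prob_update p e A x
  rwa [pivotalEvent_compl_eq_empty_of_isUpperSet e hA, prob_empty, sub_zero] at h

end PercRepro
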